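import Summits.QuantumFields.YangMills.Theorems.BalabanUVNodesN15KingModelFreeRGBlockSpinGauss
import Summits.QuantumFields.YangMills.Theorems.BalabanUVNodesN15KingModelFreeRGForms
import Literature.MathematicalPhysics.QuantumFieldTheory.King1986.CovarianceSplittingB1
import Literature.MathematicalPhysics.QuantumFieldTheory.King1986.TorusCongr
import HarnessLib

/-!
# BalabanUVNodes ∕ N15 — THE KING-MODEL RUNG, FREE-FIELD EDITION (PART Τ-i₂): KING'S OPERATORS ARE THE BLOCK-SPIN STEP'S OPERATORS —
# (2.13)–(2.14) **as a Gaussian INTEGRAL identity** for `King1986.Torus.effLaplacian` (`∫dψ e^{−½E_φ(ψ)} = 𝒩(N^{−d}A₀)·e^{−½⟨φ,Δ_effφ⟩}`), the BARE and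
# the ITERATED step in part Τ-i₁'s vocabulary (`s·Δ_eff = bsEff (a·s) Q_N (−Δ¹+m²)`, `s·Δ^{(k+1)} = bsEff (aL^{d−2}) Q_L Δ^{(k)}` ⇐ the tree's
# `effLaplacian_succ_flatten`), the ENGINE `ρ_{Δ′} = √(a∕2π)^n ∫ e^{−½a‖·−√s·Q h‖²}ρ_T(h) dh`, and its transport along `torCongr` relabellings
# (Track A, DAG node N15 = NE2; FAN-OUT v1.1 §N15 s3 «KING-MODEL RUNG»; regen R453 (b))

HONEST FRAMING.  Count-neutral (cell `pub-ymgap`, seat `pub-ymgap-dag-n15-e` g20; `--supports stmt-QuantumFields-27366 --as helper` = K3⁸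
`SpineGivenEndpointR13SepCoPHV`).  TEMPLATE LITERATURE, `A = 0`, FREE FIELD: the middle file of PART Τ-i (Τ-i₁ `…FreeRGBlockSpinGauss` = generic
Gaussian block-spin calculus; Τ-i₃ `…FreeRGBlockSpinStep` = the renormalization-group step BY NAME on part Τ-e's datum `kingFreeRG`).  WHAT IS HERE:
* §1 THE ENGINE `density_of_bsEff_eq_smul`: if `bsEff (a·s) Q T = s·Δ′` then `ρ_{Δ′}(φ′) = √(a∕2π)^{|κ|}∫dh e^{−½a‖φ′−√s·Qh‖²}ρ_T(h)`
  (`ρ_X = e^{−½⟨·,X·⟩}∕𝒩(X)`; part Τ-i₁ `blockSpin_density` with the coarse variable rescaled by `√s`, `gaussNorm_smul`);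
* §2 KING'S OPERATORS ARE THE ENGINE'S: the BARE step `s·effLaplacian N M a N² (N²m²) = bsEff (a·s) Q_N (lapF 1 m²)`, `s = N^d∕N²` (`lapF_scale`,
  `QᵀQ = N^{−d}·blockProj`), and the ITERATED step `s·Δ^{(k+1)} = bsEff (aL^{d−2}) Q_L Δ^{(k)}`, `s = L^d∕L²` — the tree's operator-level composition
  law `King1986.Torus.effLaplacian_succ_flatten` ([Ba1] (2.18)∕(2.21) `B1RG242.StepData.display221_succ` for King's operators, part L of the slices
  lineage) read through `oneStepCov = (Δ^{(k)} + aL⁻²Q*Q)⁻¹`;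
* §3 ★ `integral_exp_energy` — KING'S (2.13)–(2.14) AS A GAUSSIAN INTEGRAL: `∫dψ exp(−½E_φ(ψ)) = 𝒩(N^{−d}A₀)·exp(−½⟨φ,Δ_effφ⟩)` for
  `E_φ = King1986.Torus.energy` ((2.4) applied to the fine Gaussian `e^{−½η^d⟨ψ,(c(−Δ)+m²)ψ⟩}`): the docstring claim of `effLaplacian` («the quadratic
  form produced by the Gaussian block integral … ∝ ∫dψ …») as an EQUALITY with its constant (the tree's `effLaplacian_eq_energy` is the `min_ψ`);
  `blockSpin_density_effLaplacian` the mass-one version;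
* §4 transports along `King1986.Torus.torCongr` (`Π ℤ∕(N·M_μ)` respelled): `Qmat_torCongr`, `effLaplacian_torCongr`, `effLaplacian_congrN`, the
  quadratic form ∕ `𝒩` ∕ Lebesgue-integral invariance under `g ↦ g∘e` (`volume_measurePreserving_piCongrLeft`), and ★ `density_transport_engine`
  (the engine with the fine carrier relabelled) — what Τ-i₃ instantiates twice.
WHY THE POWER `(d−2)∕2` (used by Τ-i₃): with the weight `e^{−(β∕2)‖ψ−Q_Lφ‖²}`, `β = aL^{d−2}` (= (2.13)'s `a(Lη)^{−2}·(Lη)^d` in level-`k` units)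
the effective operator in `ψ` is `L^{d−2}Δ^{(k+1)}`; the field carrying `Δ^{(k+1)}` is `φ′ = L^{(d−2)∕2}ψ` — the canonical dimension of the scalar
field, (2.20) `G^ε = (ε∕η)^{2−d}G^η`; any other power would not reproduce `a_{k+1}` and the unit-lattice mass.
DEDUP: the operator-level law is the tree's (`effLaplacian_succ_flatten`, `effLaplacian₂_eq`); the conditional Gaussian step over sub-domains is
lit-balaban p15's (`B2Eq234SecondRepr`); new here = the integral-level readings in King's vocabulary.  NOT Bałaban's objects; NOT a node discharge;
nothing continuum-YM ∕ ℝ⁴ ∕ OS ∕ mass-gap ∕ Clay.  0 `sorry`; NO definition; standard axioms.  READING NOTE (ref-K READ-340, carried): every `𝒩(·)`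
and `ρ` identity below holds under the stated coercivity letters; outside them `gaussNorm` is Bochner junk.
Locators: [King1986] (2.4)–(2.6) p.652, (2.10) p.653, (2.13)–(2.16) p.653, (2.20) p.654; [Balaban1982Higgs1] (2.18)∕(2.21) p.610 (via the tree's `B1RG242`).
-/

noncomputable section

namespace Summit.QuantumFields.YangMills.BalabanUVNodes.N15KingModelRung.FreeField

open Real Finset Matrix MeasureTheory
open Literature.MathematicalPhysics.QuantumFieldTheory.Balaban1983to89.QGQInverse (Coercive isUnit_of_coercive)
open Literature.MathematicalPhysics.QuantumFieldTheory.Balaban1983to89.B5Prop11Plancherel (Tor fine)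
open Literature.MathematicalPhysics.QuantumFieldTheory.King1986 (aK aK_pos aK_one)
open Literature.MathematicalPhysics.QuantumFieldTheory.King1986.Torus (effLaplacian effLaplacian_succ_flatten energy fineOp fineOp_isUnit
  fineOp_eq_reindex_torCongr lapF lapF_scale lapF_torCongr lapF_coercive Qmat transpose_Qmat_mul_Qmat blockProj blockOf_torCongr oneStepCov
  torCongr fineCongr)
open Literature.LinearAlgebra.Matrix (dotProduct_self_nonneg_real)

variable {d : ℕ}

/-! ## §1 The engine: a rescaled coarse variable in part Τ-i₁'s mass-one block-spin identity -/

section Engine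

variable {ι κ : Type*} [Fintype ι] [Fintype κ] [DecidableEq ι] [DecidableEq κ]

/-- `√s^n = s^{n∕2}` and King's scaling letter: `s^{−n∕2} = (√s^n)⁻¹` (`s > 0`). [folklore] -/
theorem rpow_neg_half_card_eq_inv_sqrt_pow {s : ℝ} (hs : 0 < s) (n : ℕ) :
    s ^ (-((n : ℝ) / 2)) = (Real.sqrt s ^ n)⁻¹ := by
  rw [Real.sqrt_eq_rpow, ← Real.rpow_natCast, ← Real.rpow_mul hs.le, Real.rpow_neg hs.le]
  congr 1
  congr 1
  ring

omit [DecidableEq ι] [DecidableEq κ] in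
/-- Rescaling the coarse variable in the block-spin weight: with `ψ = (√s)⁻¹φ′`, `(a·s)‖ψ − Qh‖² = a‖φ′ − √s·Qh‖²`. [cite: King1986, (2.20) p.654] -/
theorem rescaled_weight_eq {a s : ℝ} (hs : 0 < s) (Q : Matrix κ ι ℝ) (φ' : κ → ℝ) (h : ι → ℝ) :
    a * s * ((((Real.sqrt s)⁻¹ • φ') - Q *ᵥ h) ⬝ᵥ (((Real.sqrt s)⁻¹ • φ') - Q *ᵥ h))
      = a * ((φ' - Real.sqrt s • (Q *ᵥ h)) ⬝ᵥ (φ' - Real.sqrt s • (Q *ᵥ h))) := by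
  have hr : 0 < Real.sqrt s := Real.sqrt_pos.mpr hs
  have hv : (Real.sqrt s)⁻¹ • φ' - Q *ᵥ h = (Real.sqrt s)⁻¹ • (φ' - Real.sqrt s • (Q *ᵥ h)) := by
    rw [smul_sub, smul_smul, inv_mul_cancel₀ hr.ne', one_smul]
  have hss : (Real.sqrt s)⁻¹ * (Real.sqrt s)⁻¹ = s⁻¹ := by
    rw [← mul_inv, Real.mul_self_sqrt hs.le]
  rw [hv, smul_dotProduct, dotProduct_smul, smul_eq_mul, smul_eq_mul, ← mul_assoc ((Real.sqrt s)⁻¹), hss,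
    mul_assoc, mul_inv_cancel_left₀ hs.ne']

omit [DecidableEq κ] in
/-- Rescaling the coarse variable in the effective form: with `ψ = (√s)⁻¹φ′`, `⟨ψ, (s·Δ′)ψ⟩ = ⟨φ′, Δ′φ′⟩`. [cite: King1986, (2.20) p.654] -/
theorem rescaled_form_eq {s : ℝ} (hs : 0 < s) (Δ' : Matrix κ κ ℝ) (φ' : κ → ℝ) :
    ((Real.sqrt s)⁻¹ • φ') ⬝ᵥ ((s • Δ') *ᵥ ((Real.sqrt s)⁻¹ • φ')) = φ' ⬝ᵥ (Δ' *ᵥ φ') := by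
  have hr : 0 < Real.sqrt s := Real.sqrt_pos.mpr hs
  rw [Matrix.smul_mulVec, Matrix.mulVec_smul, smul_dotProduct, dotProduct_smul, dotProduct_smul, smul_eq_mul, smul_eq_mul,
    smul_eq_mul, ← mul_assoc, ← mul_assoc, mul_comm ((Real.sqrt s)⁻¹) s, mul_assoc s, ← mul_inv,
    Real.mul_self_sqrt hs.le, mul_inv_cancel₀ hs.ne', one_mul]

/-- ★ **THE ENGINE** (part Τ-i₁ `blockSpin_density` with the coarse field rescaled by `√s`): if the effective operator of the step with Gaussian constant
`a·s` is `s` times a coarse operator `Δ′` — `bsEff (a·s) Q T = s·Δ′` — then for every coarse field `φ′`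
`ρ_{Δ′}(φ′) = √(a∕2π)^{|κ|} · ∫dh exp(−½a‖φ′ − √s·Qh‖²)·ρ_T(h)`, `ρ_X = e^{−½⟨·,X·⟩}∕𝒩(X)`: the mass-one Gaussian of `T` is carried to the mass-one
Gaussian of `Δ′` by the block average `√s·Q` with King's constant `(a∕2π)^{n∕2}`. [cite: King1986, (2.4)–(2.6) p.652, (2.13)–(2.15) p.653, (2.20) p.654] -/
theorem density_of_bsEff_eq_smul (Q : Matrix κ ι ℝ) {T : Matrix ι ι ℝ} {δ : ℝ} (hδ : 0 < δ) (hT : Coercive T δ) (hsymm : Tᵀ = T)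
    {a s : ℝ} (ha : 0 < a) (hs : 0 < s) {Δ' : Matrix κ κ ℝ} (hE : bsEff (a * s) Q T = s • Δ') (φ' : κ → ℝ) :
    Real.exp (-(1 / 2 : ℝ) * (φ' ⬝ᵥ (Δ' *ᵥ φ'))) / gaussNorm Δ'
      = Real.sqrt (a / (2 * π)) ^ Fintype.card κ
        * ∫ h : ι → ℝ, Real.exp (-(1 / 2 : ℝ) * (a * ((φ' - Real.sqrt s • (Q *ᵥ h)) ⬝ᵥ (φ' - Real.sqrt s • (Q *ᵥ h)))))
            * (Real.exp (-(1 / 2 : ℝ) * (h ⬝ᵥ (T *ᵥ h))) / gaussNorm T) := by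
  have hβ : 0 < a * s := mul_pos ha hs
  have hr : 0 < Real.sqrt s := Real.sqrt_pos.mpr hs
  have hd := blockSpin_density Q hδ hT hsymm hβ ((Real.sqrt s)⁻¹ • φ')
  rw [hE, rescaled_form_eq hs, gaussNorm_smul hs, rpow_neg_half_card_eq_inv_sqrt_pow hs] at hd
  simp_rw [rescaled_weight_eq hs Q φ'] at hd
  -- `hd : √(as/2π)^n · I = e^{−½⟨φ′,Δ′φ′⟩} / ((√s^n)⁻¹ · 𝒩(Δ′))`
  have hsplit : Real.sqrt (a * s / (2 * π)) = Real.sqrt (a / (2 * π)) * Real.sqrt s := by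
    rw [← Real.sqrt_mul (div_nonneg ha.le (by positivity))]
    congr 1
    ring
  rw [hsplit, mul_pow] at hd
  have hc : (Real.sqrt s ^ Fintype.card κ) ≠ 0 := pow_ne_zero _ hr.ne'
  set I := ∫ h : ι → ℝ, Real.exp (-(1 / 2 : ℝ) * (a * ((φ' - Real.sqrt s • (Q *ᵥ h)) ⬝ᵥ (φ' - Real.sqrt s • (Q *ᵥ h)))))
      * (Real.exp (-(1 / 2 : ℝ) * (h ⬝ᵥ (T *ᵥ h))) / gaussNorm T) with hI
  set E := Real.exp (-(1 / 2 : ℝ) * (φ' ⬝ᵥ (Δ' *ᵥ φ'))) with hEdef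
  -- divide `hd` by `√s^n`
  have h2 : E / ((Real.sqrt s ^ Fintype.card κ)⁻¹ * gaussNorm Δ') = Real.sqrt s ^ Fintype.card κ * (E / gaussNorm Δ') := by
    rw [div_mul_eq_div_div, div_inv_eq_mul]
    ring
  rw [h2] at hd
  have h3 : Real.sqrt s ^ Fintype.card κ * (Real.sqrt (a / (2 * π)) ^ Fintype.card κ * I)
      = Real.sqrt s ^ Fintype.card κ * (E / gaussNorm Δ') := by
    rw [← hd]
    ring
  exact (mul_left_cancel₀ hc h3).symm

end Engine

/-! ## §2 King's operators ARE the engine's operators -/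

section Operators

variable (N : ℕ) [NeZero N] (M : Fin d → ℕ) [hM : ∀ μ, NeZero (M μ)]

/-- `β·QᵀQ = (β∕N^d)·Q*Q` for King's block mean (`QᵀQ = N^{−d}·blockProj`). [cite: King1986, (2.10) p.653, (2.13) p.653] -/
theorem bsPrec_Qmat (β : ℝ) (T : Matrix (Tor (fine N M)) (Tor (fine N M)) ℝ) :
    bsPrec β (Qmat N M) T = T + (β * (((N : ℝ) ^ d)⁻¹)) • blockProj N M := by
  rw [bsPrec, transpose_Qmat_mul_Qmat, smul_smul]

/- `(t • A)⁻¹ = t⁻¹ • A⁻¹` for invertible `A`, `t ≠ 0` is the tree's `Balaban1983to89.Beta.WoodburyFibre.inv_smul_of_isUnit`; to keep the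
import closure light it is re-derived INLINE (two lines, `Matrix.inv_eq_right_inv`) where used, not re-declared. -/

/-- **THE BARE STEP**: King's effective Laplacian at `N` levels in one shot, `Δ_eff(N, a, c = N², N²m²) = a − a²N^dQ(N²(−Δ¹+m²) + aQ*Q)⁻¹Qᵀ`,
rescaled by `s = N^d∕N²`, IS the block-spin effective operator of the bare unit-lattice action `−Δ¹ + m²` with Gaussian constant `a·s`:
`s·Δ_eff = bsEff (a·s) Q_N (lapF 1 m²)`. [cite: King1986, (2.13)–(2.14) p.653, (2.20) p.654] -/
theorem smul_effLaplacian_bare_eq_bsEff {a m2 : ℝ} (ha : 0 < a) (hm : 0 < m2) :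
    (((N : ℝ) ^ d) / (N : ℝ) ^ 2) • effLaplacian N M a ((N : ℝ) ^ 2) ((N : ℝ) ^ 2 * m2)
      = bsEff (a * (((N : ℝ) ^ d) / (N : ℝ) ^ 2)) (Qmat N M) (lapF (fine N M) 1 m2) := by
  have hN0 : (0 : ℝ) < N := by exact_mod_cast Nat.pos_of_ne_zero (NeZero.ne N)
  have hN2 : ((N : ℝ) ^ 2) ≠ 0 := pow_ne_zero _ hN0.ne'
  have hNd : ((N : ℝ) ^ d) ≠ 0 := pow_ne_zero _ hN0.ne'
  set s : ℝ := ((N : ℝ) ^ d) / (N : ℝ) ^ 2 with hs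
  set T := lapF (fine N M) 1 m2 with hT
  -- the bare precision: `fineOp = N²·bsPrec`
  have hB : bsPrec (a * s) (Qmat N M) T = T + (a * ((N : ℝ) ^ 2)⁻¹) • blockProj N M := by
    rw [bsPrec_Qmat, hs]
    congr 2
    field_simp
  have hfine : fineOp N M a ((N : ℝ) ^ 2) ((N : ℝ) ^ 2 * m2) = ((N : ℝ) ^ 2) • bsPrec (a * s) (Qmat N M) T := by
    rw [hB, fineOp, smul_add, smul_smul, hT, ← lapF_scale, mul_one]
    congr 2
    rw [mul_comm a, ← mul_assoc, mul_inv_cancel₀ hN2, one_mul]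
  have hTc : Coercive T m2 := by rw [hT]; exact lapF_coercive (fine N M) 1 m2 zero_le_one
  have hBu : IsUnit (bsPrec (a * s) (Qmat N M) T) :=
    isUnit_of_coercive hm (coercive_bsPrec (Qmat N M) T (mul_nonneg ha.le (by positivity)) hTc)
  have hinv : (((N : ℝ) ^ 2) • bsPrec (a * s) (Qmat N M) T)⁻¹ = ((N : ℝ) ^ 2)⁻¹ • (bsPrec (a * s) (Qmat N M) T)⁻¹ := by
    refine Matrix.inv_eq_right_inv ?_
    rw [Matrix.smul_mul, Matrix.mul_smul, smul_smul, mul_inv_cancel₀ hN2, one_smul,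
      Matrix.mul_nonsing_inv _ ((Matrix.isUnit_iff_isUnit_det _).mp hBu)]
  rw [effLaplacian, hfine, hinv, bsEff, smul_sub, smul_smul, smul_smul, Matrix.mul_smul, Matrix.smul_mul, smul_smul]
  congr 1
  · rw [mul_comm]
  · congr 1
    rw [hs]
    field_simp

variable (L : ℕ) [NeZero L]

/-- **THE ITERATED STEP** (the tree's operator-level composition law `effLaplacian_succ_flatten` = [Ba1] (2.18)∕(2.21) for King's operators, read
through `oneStepCov = (Δ^{(k)} + aL⁻²Q*Q)⁻¹`): King's `Δ^{(k+1)}` (block size `L^k·L`, constant `a_{k+1}`, unit-lattice mass `L²m²`), rescaled by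
`s = L^d∕L²`, IS the block-spin effective operator of `Δ^{(k)}` (block size `L^k`, constant `a_k`, mass `m²`, on the level-`k` unit lattice
`Π ℤ∕(L·M)`) with Gaussian constant `a·s = aL^{d−2}`: `s·Δ^{(k+1)} = bsEff (aL^{d−2}) Q_L Δ^{(k)}`.
[cite: King1986, (2.13)–(2.16) p.653, (2.20) p.654; Balaban1982Higgs1, (2.18)/(2.21) p.610] -/
theorem smul_effLaplacian_succ_eq_bsEff {a m2 : ℝ} (ha : 0 < a) (hL : 2 ≤ L) {k : ℕ} (hk : 1 ≤ k) (hm : 0 < m2) :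
    (((L : ℝ) ^ d) / (L : ℝ) ^ 2) • effLaplacian (L ^ k * L) M (aK a L (k + 1)) (((L ^ k * L : ℕ) : ℝ) ^ 2) (((L : ℝ) ^ 2) * m2)
      = bsEff (a * (((L : ℝ) ^ d) / (L : ℝ) ^ 2)) (Qmat L M)
          (effLaplacian (L ^ k) (fine L M) (aK a L k) (((L ^ k : ℕ) : ℝ) ^ 2) m2) := by
  have hL0 : (0 : ℝ) < L := by exact_mod_cast (show 0 < L by omega)
  have hL2 : ((L : ℝ) ^ 2) ≠ 0 := pow_ne_zero _ hL0.ne'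
  have hLd : ((L : ℝ) ^ d) ≠ 0 := pow_ne_zero _ hL0.ne'
  set s : ℝ := ((L : ℝ) ^ d) / (L : ℝ) ^ 2 with hs
  set T := effLaplacian (L ^ k) (fine L M) (aK a L k) (((L ^ k : ℕ) : ℝ) ^ 2) m2 with hT
  have hB : bsPrec (a * s) (Qmat L M) T = T + (a * ((L : ℝ) ^ 2)⁻¹) • blockProj L M := by
    rw [bsPrec_Qmat, hs]
    congr 2
    field_simp
  have hC : oneStepCov (L ^ k) L M (aK a L k) a (((L ^ k : ℕ) : ℝ) ^ 2) m2 = (bsPrec (a * s) (Qmat L M) T)⁻¹ := by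
    rw [oneStepCov, hB, hT]
  have hflat := effLaplacian_succ_flatten (L ^ k) L M a m2 ha hL hk hm
  rw [hflat, hC, bsEff, smul_sub, smul_smul, smul_smul, smul_sub, smul_smul, smul_smul]
  have e1 : s * ((L : ℝ) ^ 2 * (a * ((L : ℝ) ^ 2)⁻¹)) = a * s := by
    field_simp
  have e2 : s * ((L : ℝ) ^ 2 * ((a * ((L : ℝ) ^ 2)⁻¹) ^ 2 * (L : ℝ) ^ d)) = (a * s) ^ 2 := by
    rw [hs]
    field_simp
  rw [e1, e2]

end Operators

/-! ## §3 ★ King's (2.13)–(2.14) AS A GAUSSIAN INTEGRAL: `∫dψ e^{−½E_φ(ψ)} = 𝒩(N^{−d}A₀)·e^{−½⟨φ,Δ_effφ⟩}` -/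

section BlockIntegral

variable (N : ℕ) [NeZero N] (M : Fin d → ℕ) [hM : ∀ μ, NeZero (M μ)]

/-- King's energy functional in part Τ-i₁'s shape: `E_φ(ψ) = a‖φ − Qψ‖² + ⟨ψ, (N^{−d}(c(−Δ)+m²))ψ⟩`. [cite: King1986, (2.4) p.652, (2.14) p.653] -/
theorem energy_eq_blockSpin (a c m2 : ℝ) (φ : Tor M → ℝ) (ψ : Tor (fine N M) → ℝ) :
    energy N M a c m2 φ ψ
      = a * ((φ - Qmat N M *ᵥ ψ) ⬝ᵥ (φ - Qmat N M *ᵥ ψ)) + ψ ⬝ᵥ (((((N : ℝ) ^ d)⁻¹) • lapF (fine N M) c m2) *ᵥ ψ) := by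
  rw [energy, Matrix.smul_mulVec, dotProduct_smul, smul_eq_mul]

/-- The bare precision of the `N`-block step is `N^{−d}A₀`: `N^{−d}(c(−Δ)+m²) + a·QᵀQ = N^{−d}·fineOp`. [cite: King1986, (2.13) p.653] -/
theorem bsPrec_energy (a c m2 : ℝ) :
    bsPrec a (Qmat N M) ((((N : ℝ) ^ d)⁻¹) • lapF (fine N M) c m2) = (((N : ℝ) ^ d)⁻¹) • fineOp N M a c m2 := by
  rw [bsPrec_Qmat, fineOp, smul_add, smul_smul, mul_comm]

/-- The effective operator of the `N`-block step on the fine Gaussian IS King's `Δ_eff`: `bsEff a Q_N (N^{−d}(c(−Δ)+m²)) = effLaplacian N M a c m²`.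
[cite: King1986, (2.14) p.653] -/
theorem bsEff_energy {a c m2 : ℝ} (ha : 0 ≤ a) (hc : 0 ≤ c) (hm : 0 < m2) :
    bsEff a (Qmat N M) ((((N : ℝ) ^ d)⁻¹) • lapF (fine N M) c m2) = effLaplacian N M a c m2 := by
  have hN0 : (0 : ℝ) < N := by exact_mod_cast Nat.pos_of_ne_zero (NeZero.ne N)
  have hNd : ((N : ℝ) ^ d) ≠ 0 := pow_ne_zero _ hN0.ne'
  have hinv : ((((N : ℝ) ^ d)⁻¹) • fineOp N M a c m2)⁻¹ = ((N : ℝ) ^ d) • (fineOp N M a c m2)⁻¹ := by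
    refine Matrix.inv_eq_right_inv ?_
    rw [Matrix.smul_mul, Matrix.mul_smul, smul_smul, inv_mul_cancel₀ hNd, one_smul,
      Matrix.mul_nonsing_inv _ ((Matrix.isUnit_iff_isUnit_det _).mp (fineOp_isUnit N M ha hc hm))]
  rw [bsEff, bsPrec_energy, hinv, effLaplacian, Matrix.mul_smul, Matrix.smul_mul, smul_smul]

/-- ★ **KING'S (2.13)–(2.14) AS A GAUSSIAN INTEGRAL** (the docstring claim of `King1986.Torus.effLaplacian` made an equality, constant included):
for `a ≥ 0`, `c ≥ 0`, `m² > 0` and every unit-lattice field `φ`, `∫ dψ exp(−½E_φ(ψ)) = 𝒩(N^{−d}A₀) · exp(−½⟨φ, Δ_eff φ⟩)`, where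
`E_φ(ψ) = a‖φ − Q_Nψ‖² + η^d⟨ψ,(c(−Δ)+m²)ψ⟩` is the exponent of the renormalization transformation `T_{a,N}` (2.4) applied to the fine Gaussian,
`A₀ = c(−Δ) + m² + aQ*Q` King's minimisation operator and `Δ_eff = a − a²N^dQA₀⁻¹Qᵀ` his effective Laplacian (2.14) (`Δ^{(k)}` at `N = L^k`,
`a = a_k`, `c = N²`). Part K's `effLaplacian_eq_energy` is the `min_ψ` of the exponent; this is the integral. [cite: King1986, (2.4)–(2.6) p.652, (2.13)–(2.14) p.653] -/
theorem integral_exp_energy {a c m2 : ℝ} (ha : 0 ≤ a) (hc : 0 ≤ c) (hm : 0 < m2) (φ : Tor M → ℝ) :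
    ∫ ψ : Tor (fine N M) → ℝ, Real.exp (-(1 / 2 : ℝ) * energy N M a c m2 φ ψ)
      = gaussNorm ((((N : ℝ) ^ d)⁻¹) • fineOp N M a c m2) * Real.exp (-(1 / 2 : ℝ) * (φ ⬝ᵥ (effLaplacian N M a c m2 *ᵥ φ))) := by
  have hN0 : (0 : ℝ) < N := by exact_mod_cast Nat.pos_of_ne_zero (NeZero.ne N)
  have hNdi : 0 < (((N : ℝ) ^ d)⁻¹) := inv_pos.mpr (pow_pos hN0 _)
  have hT : Coercive ((((N : ℝ) ^ d)⁻¹) • lapF (fine N M) c m2) ((((N : ℝ) ^ d)⁻¹) * m2) :=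
    coercive_smul (lapF_coercive (fine N M) c m2 hc) hNdi.le
  have hsymm : ((((N : ℝ) ^ d)⁻¹) • lapF (fine N M) c m2)ᵀ = (((N : ℝ) ^ d)⁻¹) • lapF (fine N M) c m2 := by
    rw [Matrix.transpose_smul, lapF_transpose]
  simp_rw [energy_eq_blockSpin]
  rw [integral_exp_blockSpin (Qmat N M) (mul_pos hNdi hm) hT hsymm ha φ, bsPrec_energy, bsEff_energy N M ha hc hm]

/-- The same on MASS-ONE DENSITIES (part Τ-i₁ `blockSpin_density`): `√(a∕2π)^{|Ω|} ∫dψ e^{−½a‖φ−Q_Nψ‖²} ρ_{N^{−d}(c(−Δ)+m²)}(ψ) = ρ_{Δ_eff}(φ)` —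
King's `T_{a,N}` with its constant `N` (2.6)∕(2.15) maps the normalised fine Gaussian to the normalised Gaussian of `Δ_eff` (`a > 0`).
[cite: King1986, (2.4)–(2.6) p.652, (2.13)–(2.15) p.653] -/
theorem blockSpin_density_effLaplacian {a c m2 : ℝ} (ha : 0 < a) (hc : 0 ≤ c) (hm : 0 < m2) (φ : Tor M → ℝ) :
    Real.sqrt (a / (2 * π)) ^ Fintype.card (Tor M)
        * ∫ ψ : Tor (fine N M) → ℝ, Real.exp (-(1 / 2 : ℝ) * (a * ((φ - Qmat N M *ᵥ ψ) ⬝ᵥ (φ - Qmat N M *ᵥ ψ))))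
            * (Real.exp (-(1 / 2 : ℝ) * (ψ ⬝ᵥ (((((N : ℝ) ^ d)⁻¹) • lapF (fine N M) c m2) *ᵥ ψ)))
                / gaussNorm ((((N : ℝ) ^ d)⁻¹) • lapF (fine N M) c m2))
      = Real.exp (-(1 / 2 : ℝ) * (φ ⬝ᵥ (effLaplacian N M a c m2 *ᵥ φ))) / gaussNorm (effLaplacian N M a c m2) := by
  have hN0 : (0 : ℝ) < N := by exact_mod_cast Nat.pos_of_ne_zero (NeZero.ne N)
  have hNdi : 0 < (((N : ℝ) ^ d)⁻¹) := inv_pos.mpr (pow_pos hN0 _)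
  have hT : Coercive ((((N : ℝ) ^ d)⁻¹) • lapF (fine N M) c m2) ((((N : ℝ) ^ d)⁻¹) * m2) :=
    coercive_smul (lapF_coercive (fine N M) c m2 hc) hNdi.le
  have hsymm : ((((N : ℝ) ^ d)⁻¹) • lapF (fine N M) c m2)ᵀ = (((N : ℝ) ^ d)⁻¹) • lapF (fine N M) c m2 := by
    rw [Matrix.transpose_smul, lapF_transpose]
  rw [blockSpin_density (Qmat N M) (mul_pos hNdi hm) hT hsymm ha φ, bsEff_energy N M ha.le hc hm]

end BlockIntegral

/-! ## §4 Transport along the relabelling `Π ℤ∕(L·M_μ) ≃ Π ℤ∕M′_μ` (`torCongr`): block means, effective Laplacians, forms, `𝒩`, integrals -/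

section Transport

variable (N : ℕ) [NeZero N] {M M' : Fin d → ℕ} [hM : ∀ μ, NeZero (M μ)] [hM' : ∀ μ, NeZero (M' μ)]

/-- **The block mean does not see the spelling of the unit lattice.** [cite: King1986, (2.10) p.653, (2.20) p.654] -/
theorem Qmat_torCongr (h : ∀ μ, M μ = M' μ) (b : Tor M) (z : Tor (fine N M)) :
    Qmat N M' (torCongr h b) (torCongr (fineCongr N h) z) = Qmat N M b z := by
  simp only [Qmat, blockOf_torCongr N h, (torCongr h).injective.eq_iff]

/-- The entries of `A₀⁻¹` transport. [cite: King1986, (2.13) p.653, (2.20) p.654] -/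
theorem fineOp_inv_torCongr (h : ∀ μ, M μ = M' μ) (a c m2 : ℝ) (x y : Tor (fine N M)) :
    (fineOp N M' a c m2)⁻¹ (torCongr (fineCongr N h) x) (torCongr (fineCongr N h) y) = (fineOp N M a c m2)⁻¹ x y := by
  rw [fineOp_eq_reindex_torCongr N h, Matrix.inv_reindex, Matrix.reindex_apply, Matrix.submatrix_apply, Equiv.symm_apply_apply,
    Equiv.symm_apply_apply]

/-- **KING'S `Δ_eff` DOES NOT SEE THE SPELLING OF THE UNIT LATTICE**: `effLaplacian N M′ (e b) (e b′) = effLaplacian N M b b′` along `torCongr`.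
[cite: King1986, (2.14) p.653, (2.20) p.654] -/
theorem effLaplacian_torCongr (h : ∀ μ, M μ = M' μ) (a c m2 : ℝ) (b b' : Tor M) :
    effLaplacian N M' a c m2 (torCongr h b) (torCongr h b') = effLaplacian N M a c m2 b b' := by
  simp only [effLaplacian, Matrix.sub_apply, Matrix.smul_apply, Matrix.one_apply, (torCongr h).injective.eq_iff, Matrix.mul_apply,
    Matrix.transpose_apply, smul_eq_mul]
  congr 2
  rw [← (torCongr (fineCongr N h)).sum_comp]
  refine Finset.sum_congr rfl fun w _ => ?_
  rw [Qmat_torCongr N h b' w, ← (torCongr (fineCongr N h)).sum_comp]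
  refine congrArg (· * _) (Finset.sum_congr rfl fun z _ => ?_)
  rw [Qmat_torCongr N h b z, fineOp_inv_torCongr N h]

omit hM hM' in
/-- `effLaplacian` does not depend on the spelling of the number of fine points per block (e.g. `L^1` vs `L`): `NeZero` is a
proposition, so the two instances agree. [folklore] -/
theorem effLaplacian_congrN {N' : ℕ} [NeZero N'] (h : N = N') (K : Fin d → ℕ) [∀ μ, NeZero (K μ)] (a c m2 : ℝ) :
    effLaplacian N K a c m2 = effLaplacian N' K a c m2 := by
  subst h
  rfl

variable {X Y : Type*} [Fintype X] [Fintype Y]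

omit [NeZero N] hM hM' in
/-- Dot products transport along a relabelling of the index set. [folklore] -/
theorem dotProduct_comp_equiv (e : Y ≃ X) (g₁ g₂ : X → ℝ) : (g₁ ∘ e) ⬝ᵥ (g₂ ∘ e) = g₁ ⬝ᵥ g₂ := by
  simp only [dotProduct, Function.comp_apply]
  exact e.sum_comp (fun x => g₁ x * g₂ x)

omit [NeZero N] hM hM' in
/-- Quadratic forms transport: `⟨g∘e, (A∘(e×e))(g∘e)⟩ = ⟨g, Ag⟩`. [folklore] -/
theorem quad_submatrix_comp (e : Y ≃ X) (A : Matrix X X ℝ) (g : X → ℝ) :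
    (g ∘ e) ⬝ᵥ ((A.submatrix e e) *ᵥ (g ∘ e)) = g ⬝ᵥ (A *ᵥ g) := by
  have hge : (g ∘ e) ∘ e.symm = g := by funext x; simp
  rw [Matrix.submatrix_mulVec_equiv, hge, dotProduct_comp_equiv]

omit [NeZero N] hM hM' in
/-- **Lebesgue measure on `ℝ^X` is the image of Lebesgue measure on `ℝ^Y` under `g ↦ g∘e`** (`volume_measurePreserving_piCongrLeft`):
`∫_{ℝ^X} G(g∘e) dg = ∫_{ℝ^Y} G(h) dh`. [folklore] -/
theorem integral_comp_equiv_fun (e : Y ≃ X) (G : (Y → ℝ) → ℝ) :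
    ∫ g : X → ℝ, G (g ∘ e) = ∫ h : Y → ℝ, G h := by
  have hΦ := volume_measurePreserving_piCongrLeft (fun _ : Y => ℝ) e.symm
  have happ : ∀ g : X → ℝ, (MeasurableEquiv.piCongrLeft (fun _ : Y => ℝ) e.symm) g = g ∘ e := by
    intro g
    funext y
    have := MeasurableEquiv.piCongrLeft_apply_apply (β := fun _ : Y => ℝ) e.symm g (e y)
    rw [Equiv.symm_apply_apply] at this
    rw [this, Function.comp_apply]
  rw [← hΦ.integral_comp' G]
  simp_rw [happ]

omit [NeZero N] hM hM' in
/-- `𝒩` transports: `𝒩(A∘(e×e)) = 𝒩(A)`. [folklore] -/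
theorem gaussNorm_submatrix_equiv (e : Y ≃ X) (A : Matrix X X ℝ) : gaussNorm (A.submatrix e e) = gaussNorm A := by
  unfold gaussNorm
  rw [← integral_comp_equiv_fun e (fun h : Y → ℝ => Real.exp (-(1 / 2 : ℝ) * (h ⬝ᵥ ((A.submatrix e e) *ᵥ h))))]
  simp_rw [quad_submatrix_comp]

omit [NeZero N] hM hM' in
/-- Coercivity transports. [folklore] -/
theorem coercive_submatrix_equiv (e : Y ≃ X) {A : Matrix X X ℝ} {δ : ℝ} (hA : Coercive A δ) : Coercive (A.submatrix e e) δ := by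
  intro h
  have hh : h = (h ∘ e.symm) ∘ e := by funext y; simp
  rw [hh, quad_submatrix_comp, dotProduct_comp_equiv]
  exact hA _

omit [NeZero N] hM hM' [Fintype X] [Fintype Y] in
/-- Symmetry transports. [folklore] -/
theorem transpose_submatrix_equiv_of_symm (e : Y ≃ X) {A : Matrix X X ℝ} (hA : Aᵀ = A) : (A.submatrix e e)ᵀ = A.submatrix e e := by
  rw [Matrix.transpose_submatrix, hA]

variable {K : Type*} [Fintype K] [DecidableEq K] [DecidableEq Y]

omit [NeZero N] hM hM' in
/-- ★ **THE ENGINE ON A RELABELLED FINE CARRIER** (§1 + the transports): for a symmetric coercive `Op` on the fine fields `X → ℝ`, a relabelling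
`e : Y ≃ X`, a block average `Q : Matrix K Y ℝ`, `a, s > 0` and a coarse operator `Δ′` with `bsEff (a·s) Q (Op∘(e×e)) = s·Δ′`:
`ρ_{Δ′}(φ′) = √(a∕2π)^{|K|} ∫_{ℝ^X} dφ e^{−½a‖φ′ − √s·Q(φ∘e)‖²} ρ_{Op}(φ)` (Lebesgue measure is relabelling-invariant). [cite: King1986, (2.4)–(2.6) p.652, (2.13)–(2.15) p.653, (2.20) p.654] -/
theorem density_transport_engine (e : Y ≃ X) (Q : Matrix K Y ℝ) {Op : Matrix X X ℝ} {δ : ℝ} (hδ : 0 < δ) (hOp : Coercive Op δ)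
    (hOps : Opᵀ = Op) {a s : ℝ} (ha : 0 < a) (hs : 0 < s) {Δ' : Matrix K K ℝ} (hE : bsEff (a * s) Q (Op.submatrix e e) = s • Δ')
    (φ' : K → ℝ) :
    Real.exp (-(1 / 2 : ℝ) * (φ' ⬝ᵥ (Δ' *ᵥ φ'))) / gaussNorm Δ'
      = Real.sqrt (a / (2 * π)) ^ Fintype.card K
        * ∫ φ : X → ℝ, Real.exp (-(1 / 2 : ℝ) * (a * ((φ' - Real.sqrt s • (Q *ᵥ (φ ∘ e))) ⬝ᵥ (φ' - Real.sqrt s • (Q *ᵥ (φ ∘ e))))))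
            * (Real.exp (-(1 / 2 : ℝ) * (φ ⬝ᵥ (Op *ᵥ φ))) / gaussNorm Op) := by
  have hTc : Coercive (Op.submatrix e e) δ := coercive_submatrix_equiv e hOp
  have hTs : (Op.submatrix e e)ᵀ = Op.submatrix e e := transpose_submatrix_equiv_of_symm e hOps
  rw [density_of_bsEff_eq_smul Q hδ hTc hTs ha hs hE φ']
  congr 1
  rw [← integral_comp_equiv_fun e (fun h : Y → ℝ =>
    Real.exp (-(1 / 2 : ℝ) * (a * ((φ' - Real.sqrt s • (Q *ᵥ h)) ⬝ᵥ (φ' - Real.sqrt s • (Q *ᵥ h)))))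
      * (Real.exp (-(1 / 2 : ℝ) * (h ⬝ᵥ (Op.submatrix e e *ᵥ h))) / gaussNorm (Op.submatrix e e)))]
  refine integral_congr_ae (Filter.Eventually.of_forall fun φ => ?_)
  beta_reduce
  rw [quad_submatrix_comp, gaussNorm_submatrix_equiv]

end Transport

end Summit.QuantumFields.YangMills.BalabanUVNodes.N15KingModelRung.FreeField

end
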